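import Summits.Ventures.Crystal3D.Theorems.StickyWulffConstantTextureLiminfTexShadowBothFccFirstGlue
import Summits.Ventures.Crystal3D.Theorems.StickyWulffConstantTextureLiminfTexShadowFreeDefs
import Summits.Ventures.Crystal3D.Theorems.StickyWulffConstantTextureLiminfLineCountGlueRowStrip
import HarnessLib

/-!
# TexShadow v8.1 — the «BothFcc-FIRST» glue WITHOUT the residual branch: `BilayerWallV5` from F-U, lane G's charge-`13/25` ledger and the
# three `hgen`-FREE faulted stubs (lane T, crux `TextureLiminfV5`, stmt-Ventures-23912; wulff-p2's v8.1 proposal to cf-p1 g30, 2026-08-29)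

HONEST FRAMING. Venture `Summits/Ventures/Crystal3D` (cell `crystal3d-full`), route `route-Ventures-StickyWulffConstant`, helper
`--supports` the law-v5 crux `TextureLiminfV5` (stmt-Ventures-23912).  Pure bookkeeping (census-free, standard axioms); every wall input is
a HYPOTHESIS; rung F-C1 not moved.

THE POINT (…TexShadowFreeDefs).  The residual-class exclusion `hgen` is idle in every CLOSED part of the wall glue, so the residual stub is
the generic branch minus an unused hypothesis.  Here the three closed parts are re-derived from lane G's line counts with NO frame data
and NO `hgen` (the bodies of `bilayerWallWalkerCoveredFrom_of_orientedLineCounts` / `bilayerWallRowCovFrom_of_lineCounts` /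
`bilayerWallZigFramesApartFrom_of_cert`, verbatim minus the idle binders), the `BothFcc` half lifts the `hgen`-free faulted stubs to the
`hgen`-free way stations, and the v5 `by_cases` trees run once more without `hgen` and WITHOUT the residual split:
* closed parts, frames-free: `walkerCoveredFree_of_F4`, `rowCovFree_framesApart`, `zigFramesApartFree_of_cert` (all `R₀ ≥ 6`);
* lifts: `onReachCoaxialFreeAt_of_bothFccAt`, `zigCoaxialFreeAt_of_bothFccAt`, `deficitMinFreeAt_of_bothFccAt`;
* glue: `onReachWeakZigFreeAt_of_zigSplit`, `onReachAllFreeAt_of_split`, `onReachAllFreeAt_flip₁/₂/₁₂`, `allAt_of_four_min`;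
* **`bilayerWallCharged_of_stubsFree`** (`0 ≤ c₀ ≤ 1`, `R₀ ≥ 10`) and **`bilayerWallV5_of_stubsBothFccFirstFree : E1-data → StarPairFar facts →
  10 ≤ R₀ → (∃ C, CoaxialUnifAt C R₀) → (∃ K, ∀ P₁ t₁ P₂ t₂, ¬(affine coax) → GenericWallFloorWithCharge K R₀ (13/25) P₁ t₁ P₂ t₂) →
  ((∃ C, …FaultedOnReachCoaxialFreeAt (13/25) C R₀) ∧ (∃ C, …FaultedZigCoaxialFreeAt (13/25) C R₀)) → (∃ C, HStripPayerPoolFaultedFreeAt (13/25) C R₀)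
  → BilayerWallV5`** — NINE stubs for TexShadow v8.1 (l12Local, barlowAdhesionR, E1, starPairFar, coaxialUnif, coverage, famFaulted-free,
  hStripPayerPoolFaulted-free, textureBuild); no residual stub.
WHAT THIS IS NOT: no proof of F-U, of lane G's ledger, of T-F2 or of the faulted pool; F-C1 not moved.
-/

noncomputable section

namespace Summit.Ventures.Crystal3D.Cruxes.TextureLiminf.TexShadow

open Summit.Ventures.Crystal3D Summit.Ventures.Crystal3D.Theorems Finset TentCertificate
open Literature.MathematicalPhysics.StatisticalMechanics (IsHaggSeq fccStacking barlowStacking basalMirror haggLabel barlowOffset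
  triangularVec₁ triangularVec₂)
open scoped InnerProductSpace

/-! ## The three closed parts, frames-free and `hgen`-free -/

/-- **Walker-covered cells at one `R₀ ≥ 6`, frames-free** (modulo E1 / StarPairFar): Barlow-coverable pair, table `c ≥ 0` flux-dominated at
`√2/2` ⇒ the cell.  Body = `bilayerWallWalkerCoveredFrom_of_orientedLineCounts` fed with `barlow_hlines_oriented`, minus the idle binders. -/
theorem walkerCoveredFree_of_F4 {sE : E3} (hsE : sE ∈ fccSlots)
    (hcert : ExactOnly 0 (fccSlots.filter fun w => 0 < ⟪w, sE⟫_ℝ))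
    (hDS : ∀ F₁ F₂ : E3 ≃ₗᵢ[ℝ] E3, DoubleStarCoaxialAt F₁ F₂) (hCP : CapPairCoaxial) {R₀ : ℝ} (hR₀ : 6 ≤ R₀) :
    ∃ C : ℝ, ∀ (σ₁ σ₂ : ℤ → ℤ), IsHaggSeq σ₁ → IsHaggSeq σ₂ → ∀ (L₁ L₂ : E3 ≃ₗᵢ[ℝ] E3) (s₁ s₂ : E3),
      BarlowCoverable L₁ s₁ σ₁ L₂ s₂ σ₂ → ∀ c : ℤ → ℤ → ℝ, (∀ i j, 0 ≤ c i j) →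
      FluxDominated (Real.sqrt 2 / 2) L₁ σ₁ L₂ σ₂ c → BilayerWallAt C R₀ σ₁ σ₂ L₁ L₂ s₁ s₂ c := by
  refine ⟨((318 + 192 * R₀) + 80 * (R₀ + 9) + 3456 + 1152 * (R₀ + 1)) / 2, ?_⟩
  intro σ₁ σ₂ hσ₁ hσ₂ L₁ L₂ s₁ s₂ hcov c hc0 hflux
  obtain ⟨hΔ₁, hΔ₂, hO₁, hO₂, hO₃⟩ := hcov
  have hσ₁' : IsHaggSeq (upWord L₁ σ₁ e₃) := isHaggSeq_upWord L₁ hσ₁ e₃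
  have hσ₂' : IsHaggSeq (upWord L₂ σ₂ (-e₃)) := isHaggSeq_upWord L₂ hσ₂ (-e₃)
  have hst₁ := famSlot_steep_of_deltaSteep L₁ e₃ hΔ₁
  have hst₂ := famSlot_steep_of_deltaSteep L₂ (-e₃) hΔ₂
  have hO₁' : ∀ y ∈ reachSet (upFrame L₁ e₃) (upFrame L₁ e₃ ((haggLabel (upWord L₁ σ₁ e₃) 0 : ℝ) • barlowOffset 1) + s₁)
      (chainFrames e₃ (upFrame L₁ e₃) (famSlot L₁ e₃)),
      y ∉ stacking (upFrame L₂ (-e₃)) s₂ (upWord L₂ σ₂ (-e₃)) := fun y hy => by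
    rw [stacking_upFrame]; exact hO₁ y hy
  have hO₂' : ∀ y ∈ reachSet (upFrame L₂ (-e₃)) (upFrame L₂ (-e₃) ((haggLabel (upWord L₂ σ₂ (-e₃)) 0 : ℝ) • barlowOffset 1) + s₂)
      (chainFrames (-e₃) (upFrame L₂ (-e₃)) (famSlot L₂ (-e₃))),
      y ∉ stacking (upFrame L₁ e₃) s₁ (upWord L₁ σ₁ e₃) := fun y hy => by
    rw [stacking_upFrame]; exact hO₂ y hy
  obtain ⟨step₁', step₂', hsel₁', hsel₂', hF4'⟩ :=
    barlow_hlines_oriented hsE hcert hDS hCP hσ₁' hσ₂' (upFrame L₁ e₃) (upFrame L₂ (-e₃)) s₁ s₂ (upFrame_axis_nonneg L₁ e₃)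
      (upFrame_axis_nonneg L₂ (-e₃)) hst₁ hst₂ hO₁' hO₂' hO₃ R₀ hR₀
  obtain ⟨step₁, hsel₁, heq₁⟩ := selector_of_upFrame L₁ hσ₁ e₃ s₁ hsel₁'
  obtain ⟨step₂, hsel₂, heq₂⟩ := selector_of_upFrame L₂ hσ₂ (-e₃) s₂ hsel₂'
  refine bilayerWallAt_of_lineCount hσ₁ hσ₂ L₁ L₂ s₁ s₂ (Real.sqrt 2 / 2) R₀ (318 + 192 * R₀) (by linarith) c hc0 hflux
    hsel₁ hsel₂ ?_
  intro h hh ρ hρ X P₁ P₂ hX hP₁X hP₂X hcyl hP₁ hP₂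
  have hP₁' : ∀ p, p ∈ P₁ ↔ (p ∈ stacking (upFrame L₁ e₃) s₁ (upWord L₁ σ₁ e₃) ∧ -(2 * R₀) ≤ p 2 ∧ p 2 ≤ -R₀ ∧
      p 0 ^ 2 + p 1 ^ 2 ≤ ρ ^ 2) := fun p => by rw [stacking_upFrame]; exact hP₁ p
  have hP₂' : ∀ p, p ∈ P₂ ↔ (p ∈ stacking (upFrame L₂ (-e₃)) s₂ (upWord L₂ σ₂ (-e₃)) ∧ h + R₀ ≤ p 2 ∧ p 2 ≤ h + 2 * R₀ ∧
      p 0 ^ 2 + p 1 ^ 2 ≤ ρ ^ 2) := fun p => by rw [stacking_upFrame]; exact hP₂ p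
  obtain ⟨m', T₁, T₂, hm', hT₁, hT₂, hcount⟩ := hF4' h hh ρ hρ X P₁ P₂ hX hP₁X hP₂X hcyl hP₁' hP₂'
  refine ⟨m', T₁, T₂, hm', ?_, ?_, hcount⟩
  · rintro t ⟨k, hk⟩
    refine hT₁ t ⟨k, ?_⟩
    rw [heq₁ k t]
    exact hk
  · rintro t ⟨k, hk⟩
    refine hT₂ t ⟨k, ?_⟩
    rw [heq₂ k t]
    exact hk

/-- **Row-covered cells at `OffR := FramesApart`, one `R₀ ≥ 6`, frames-free** (modulo E1 / StarPairFar): row-mix-dominated table `c ≥ 0`,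
corner frames apart ⇒ the cell.  Body = `bilayerWallRowCovFrom_of_lineCounts` fed with `barlow_rowhlines_apart`, minus the idle binders. -/
theorem rowCovFree_framesApart {sE : E3} (hsE : sE ∈ fccSlots)
    (hcert : ExactOnly 0 (fccSlots.filter fun w => 0 < ⟪w, sE⟫_ℝ))
    (hDS : ∀ F₁ F₂ : E3 ≃ₗᵢ[ℝ] E3, DoubleStarCoaxialAt F₁ F₂) (hCP : CapPairCoaxial) {R₀ : ℝ} (hR₀ : 6 ≤ R₀) :
    ∃ C : ℝ, ∀ (σ₁ σ₂ : ℤ → ℤ), IsHaggSeq σ₁ → IsHaggSeq σ₂ → ∀ (L₁ L₂ : E3 ≃ₗᵢ[ℝ] E3) (s₁ s₂ : E3),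
      ∀ c : ℤ → ℤ → ℝ, (∀ i j, 0 ≤ c i j) → RowMixDominated (Real.sqrt 2 / 2) L₁ σ₁ L₂ σ₂ c →
      FramesApart L₁ s₁ σ₁ L₂ s₂ σ₂ → BilayerWallAt C R₀ σ₁ σ₂ L₁ L₂ s₁ s₂ c := by
  refine ⟨((540 + 384 * R₀) + 160 * (R₀ + 9) + 3456 + 1152 * (R₀ + 1)) / 2, ?_⟩
  intro σ₁ σ₂ hσ₁ hσ₂ L₁ L₂ s₁ s₂ c hc0 hdom hoff
  obtain ⟨step₁, step₂, hsel₁, hsel₂, hF4⟩ := barlow_rowhlines_apart hsE hcert hDS hCP R₀ hR₀ hσ₁ hσ₂ L₁ L₂ s₁ s₂ hoff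
  obtain ⟨ha₁, ha₁1, hb₁, hb₁1, -⟩ := zigW_rowW L₁ σ₁ e₃
  obtain ⟨ha₂, ha₂1, hb₂, hb₂1, -⟩ := zigW_rowW L₂ σ₂ (-e₃)
  have hτ : (1 : ℝ) / 4 ≤ Real.sqrt 2 / 2 := by have := Real.one_lt_sqrt_two; linarith
  exact bilayerWallAt_of_lineCount_rowstrip hσ₁ hσ₂ L₁ L₂ s₁ s₂ (Real.sqrt 2 / 2) R₀ (540 + 384 * R₀) hτ (by linarith)
    ha₁ ha₁1 hb₁ hb₁1 ha₂ ha₂1 hb₂ hb₂1 c hc0 (rowStripDominated_of_rowMixDominated hdom) hsel₁ hsel₂ hF4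

/-- **Zig-frames-apart cells at one `R₀ ≥ 6`, frames-free** (modulo E1 / StarPairFar): both plates Δ-steep, zig frames apart, table `c ≥ 0`
flux-dominated ⇒ the cell.  Body = `bilayerWallZigFramesApartFrom_of_cert`, minus the idle binders. -/
theorem zigFramesApartFree_of_cert {sE : E3} (hsE : sE ∈ fccSlots)
    (hcert : ExactOnly 0 (fccSlots.filter fun w => 0 < ⟪w, sE⟫_ℝ))
    (hDS : ∀ F₁ F₂ : E3 ≃ₗᵢ[ℝ] E3, DoubleStarCoaxialAt F₁ F₂) (hCP : CapPairCoaxial) {R₀ : ℝ} (hR₀ : 6 ≤ R₀) :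
    ∃ C : ℝ, ∀ (σ₁ σ₂ : ℤ → ℤ), IsHaggSeq σ₁ → IsHaggSeq σ₂ → ∀ (L₁ L₂ : E3 ≃ₗᵢ[ℝ] E3) (s₁ s₂ : E3),
      DeltaSteep L₁ e₃ → DeltaSteep L₂ (-e₃) → ZigFramesApart L₁ s₁ σ₁ L₂ s₂ σ₂ →
      ∀ c : ℤ → ℤ → ℝ, (∀ i j, 0 ≤ c i j) → FluxDominated (Real.sqrt 2 / 2) L₁ σ₁ L₂ σ₂ c →
      BilayerWallAt C R₀ σ₁ σ₂ L₁ L₂ s₁ s₂ c := by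
  refine ⟨((318 + 192 * R₀) + 80 * (R₀ + 9) + 3456 + 1152 * (R₀ + 1)) / 2, ?_⟩
  intro σ₁ σ₂ hσ₁ hσ₂ L₁ L₂ s₁ s₂ hΔ₁ hΔ₂ hZA c hc0 hFD
  have he₃' : e₃ = EuclideanSpace.single (2 : Fin 3) (1 : ℝ) := rfl
  obtain ⟨hA1, hA2, hA3⟩ := hZA
  unfold zigFrames at hA1 hA2 hA3
  rw [he₃'] at hA1 hA2 hA3 hΔ₁ hΔ₂
  obtain ⟨step₁, step₂, hsel₁, hsel₂, hF4⟩ :=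
    barlow_hlines_zigApart hsE hcert hDS hCP R₀ hR₀ hσ₁ hσ₂ L₁ L₂ s₁ s₂ hA1 hA2 hA3 hΔ₁ hΔ₂
  exact bilayerWallAt_of_lineCount hσ₁ hσ₂ L₁ L₂ s₁ s₂ (Real.sqrt 2 / 2) R₀ (318 + 192 * R₀) (by linarith) c hc0 hFD
    hsel₁ hsel₂ hF4

/-! ## Lifts: the `BothFcc` half + a `hgen`-free faulted stub ⇒ the `hgen`-free way station -/

/-- `BothFcc` half + T-F2's corner key (free) ⇒ O3 (free) at cap `c₀`. -/
theorem onReachCoaxialFreeAt_of_bothFccAt {c₀ R₀ C_B C_f : ℝ} (hR₀0 : 0 ≤ R₀) (hB : BilayerWallBothFccAt c₀ C_B R₀)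
    (hf : BilayerWallFaultedOnReachCoaxialFreeAt c₀ C_f R₀) : BilayerWallOnReachCoaxialFreeAt c₀ (max C_B C_f) R₀ := by
  intro σ₁ σ₂ hσ₁ hσ₂ L₁ L₂ s₁ s₂ A₁ A₂ u₁ u₂ hA₁ hA₂ c m hadm hdom hcl
  by_cases hfcc : BothFcc σ₁ σ₂
  · exact bilayerWallAt_mono hR₀0 (le_max_left _ _) (hB σ₁ σ₂ hσ₁ hσ₂ hfcc L₁ L₂ s₁ s₂ A₁ A₂ u₁ u₂ hA₁ hA₂ c m hadm)
  · exact bilayerWallAt_mono hR₀0 (le_max_right _ _)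
      (hf σ₁ σ₂ hσ₁ hσ₂ hfcc L₁ L₂ s₁ s₂ A₁ A₂ u₁ u₂ hA₁ hA₂ c m hadm hdom hcl)

/-- `BothFcc` half + T-F2's zig key (free) ⇒ ZO3 (free) at cap `c₀`. -/
theorem zigCoaxialFreeAt_of_bothFccAt {c₀ R₀ C_B C_f : ℝ} (hR₀0 : 0 ≤ R₀) (hB : BilayerWallBothFccAt c₀ C_B R₀)
    (hf : BilayerWallFaultedZigCoaxialFreeAt c₀ C_f R₀) : BilayerWallZigCoaxialFreeAt c₀ (max C_B C_f) R₀ := by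
  intro σ₁ σ₂ hσ₁ hσ₂ L₁ L₂ s₁ s₂ A₁ A₂ u₁ u₂ hA₁ hA₂ c m hadm hΔ₁ hΔ₂ hfl hoff hrow hzg hcl
  by_cases hfcc : BothFcc σ₁ σ₂
  · exact bilayerWallAt_mono hR₀0 (le_max_left _ _) (hB σ₁ σ₂ hσ₁ hσ₂ hfcc L₁ L₂ s₁ s₂ A₁ A₂ u₁ u₂ hA₁ hA₂ c m hadm)
  · exact bilayerWallAt_mono hR₀0 (le_max_right _ _)
      (hf σ₁ σ₂ hσ₁ hσ₂ hfcc L₁ L₂ s₁ s₂ A₁ A₂ u₁ u₂ hA₁ hA₂ c m hadm hΔ₁ hΔ₂ hfl hoff hrow hzg hcl)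

/-- `BothFcc` half + the faulted payer pool (free) ⇒ Deficit-MIN (free) at cap `c₀`, `R₀ ≥ 3`. -/
theorem deficitMinFreeAt_of_bothFccAt {c₀ R₀ C_B : ℝ} (hR3 : 3 ≤ R₀) (hB : BilayerWallBothFccAt c₀ C_B R₀)
    (hPool : ∃ C : ℝ, HStripPayerPoolFaultedFreeAt c₀ C R₀) : ∃ C : ℝ, BilayerWallDeficitMinFreeAt c₀ C R₀ := by
  obtain ⟨C, hpool⟩ := hPool
  refine ⟨max C_B ((C + 3456 + 1152 * (R₀ + 1)) / 2), ?_⟩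
  intro σ₁ σ₂ hσ₁ hσ₂ L₁ L₂ s₁ s₂ A₁ A₂ u₁ u₂ hA₁ hA₂ c m hadm hZ hR₁ hR₂ hR₃' hR₄
  have hR₀0 : 0 ≤ R₀ := by linarith
  by_cases hfcc : BothFcc σ₁ σ₂
  · exact bilayerWallAt_mono hR₀0 (le_max_left _ _) (hB σ₁ σ₂ hσ₁ hσ₂ hfcc L₁ L₂ s₁ s₂ A₁ A₂ u₁ u₂ hA₁ hA₂ c m hadm)
  · exact bilayerWallAt_mono hR₀0 (le_max_right _ _)
      (bilayerWallAt_of_payerBound hσ₁ hσ₂ L₁ L₂ s₁ s₂ R₀ C hR3 c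
        (hpool σ₁ σ₂ hσ₁ hσ₂ hfcc L₁ L₂ s₁ s₂ A₁ A₂ u₁ u₂ hA₁ hA₂ c m hadm hZ hR₁ hR₂ hR₃' hR₄))

/-! ## The `hgen`-free glue -/

/-- **Zig-frames-apart (frames-free) ∪ ZO3 (free; shared/twin classes folded in) ⇒ W (free) at cap `c₀`, one `R₀ ≥ 0`.** -/
theorem onReachWeakZigFreeAt_of_zigSplit {c₀ R₀ C₁ C₄ : ℝ} (hR₀0 : 0 ≤ R₀)
    (hC₁ : ∀ (σ₁ σ₂ : ℤ → ℤ), IsHaggSeq σ₁ → IsHaggSeq σ₂ → ∀ (L₁ L₂ : E3 ≃ₗᵢ[ℝ] E3) (s₁ s₂ : E3),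
      DeltaSteep L₁ e₃ → DeltaSteep L₂ (-e₃) → ZigFramesApart L₁ s₁ σ₁ L₂ s₂ σ₂ →
      ∀ c : ℤ → ℤ → ℝ, (∀ i j, 0 ≤ c i j) → FluxDominated (Real.sqrt 2 / 2) L₁ σ₁ L₂ σ₂ c →
      BilayerWallAt C₁ R₀ σ₁ σ₂ L₁ L₂ s₁ s₂ c)
    (hC₄ : BilayerWallZigCoaxialFreeAt c₀ C₄ R₀) : BilayerWallOnReachWeakZigFreeAt c₀ (max C₁ C₄) R₀ := by
  classical
  intro σ₁ σ₂ hσ₁ hσ₂ L₁ L₂ s₁ s₂ A₁ A₂ u₁ u₂ hu₁ hu₂ c m hadm hΔ₁ hΔ₂ hFD hBOR hRow hZG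
  by_cases hZA : ZigFramesApart L₁ s₁ σ₁ L₂ s₂ σ₂
  · exact bilayerWallAt_mono hR₀0 (le_max_left _ _) (hC₁ σ₁ σ₂ hσ₁ hσ₂ L₁ L₂ s₁ s₂ hΔ₁ hΔ₂ hZA c hadm.1 hFD)
  · have hcl : ∃ F₁ ∈ zigFrames L₁ e₃, ∃ F₂ ∈ zigFrames L₂ (-e₃), CoAxFrames F₁ F₂ := by
      rcases zigFrameClasses_of_not_zigFramesApart hZA with h | h | h
      · exact zigCoaxialClass_of_zigSharedClass h
      · exact zigCoaxialClass_of_zigTwinClass h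
      · exact h
    exact bilayerWallAt_mono hR₀0 (le_max_right _ _)
      (hC₄ σ₁ σ₂ hσ₁ hσ₂ L₁ L₂ s₁ s₂ A₁ A₂ u₁ u₂ hu₁ hu₂ c m hadm hΔ₁ hΔ₂ hFD hBOR hRow hZG hcl)

/-- **Row-covered (frames-free) ∪ zig-apart (frames-free) ∪ O3 (free) ∪ W (free) ⇒ on-reach-all (free) at `OffR := FramesApart`, cap `c₀`,
one `R₀ ≥ 0`** (`onReachAllAt_of_split`'s tree). -/
theorem onReachAllFreeAt_of_split {c₀ R₀ C₁ C₂ C₅ C₆ : ℝ} (hR₀0 : 0 ≤ R₀)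
    (hC₁ : ∀ (σ₁ σ₂ : ℤ → ℤ), IsHaggSeq σ₁ → IsHaggSeq σ₂ → ∀ (L₁ L₂ : E3 ≃ₗᵢ[ℝ] E3) (s₁ s₂ : E3),
      ∀ c : ℤ → ℤ → ℝ, (∀ i j, 0 ≤ c i j) → RowMixDominated (Real.sqrt 2 / 2) L₁ σ₁ L₂ σ₂ c →
      FramesApart L₁ s₁ σ₁ L₂ s₂ σ₂ → BilayerWallAt C₁ R₀ σ₁ σ₂ L₁ L₂ s₁ s₂ c)
    (hC₂ : ∀ (σ₁ σ₂ : ℤ → ℤ), IsHaggSeq σ₁ → IsHaggSeq σ₂ → ∀ (L₁ L₂ : E3 ≃ₗᵢ[ℝ] E3) (s₁ s₂ : E3),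
      DeltaSteep L₁ e₃ → DeltaSteep L₂ (-e₃) → ZigFramesApart L₁ s₁ σ₁ L₂ s₂ σ₂ →
      ∀ c : ℤ → ℤ → ℝ, (∀ i j, 0 ≤ c i j) → FluxDominated (Real.sqrt 2 / 2) L₁ σ₁ L₂ σ₂ c →
      BilayerWallAt C₂ R₀ σ₁ σ₂ L₁ L₂ s₁ s₂ c)
    (hC₅ : BilayerWallOnReachCoaxialFreeAt c₀ C₅ R₀) (hC₆ : BilayerWallOnReachWeakZigFreeAt c₀ C₆ R₀) :
    BilayerWallOnReachAllFreeAt FramesApart c₀ (max (max C₁ C₂) (max C₅ C₆)) R₀ := by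
  classical
  set C : ℝ := max (max C₁ C₂) (max C₅ C₆) with hCdef
  have e1 : C₁ ≤ C := le_trans (le_max_left _ _) (le_max_left _ _)
  have e2 : C₂ ≤ C := le_trans (le_max_right _ _) (le_max_left _ _)
  have e5 : C₅ ≤ C := le_trans (le_max_left _ _) (le_max_right _ _)
  have e6 : C₆ ≤ C := le_trans (le_max_right _ _) (le_max_right _ _)
  intro σ₁ σ₂ hσ₁ hσ₂ L₁ L₂ s₁ s₂ A₁ A₂ u₁ u₂ hu₁ hu₂ c m hadm H
  -- the three frame classes are ONE co-axial class, for a dominated table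
  have classes : DomBy L₁ σ₁ L₂ σ₂ c → ¬ FramesApart L₁ s₁ σ₁ L₂ s₂ σ₂ → BilayerWallAt C R₀ σ₁ σ₂ L₁ L₂ s₁ s₂ c := by
    intro hdom hFA
    have hcl : ∃ F₁ ∈ cornerFrames L₁ σ₁ e₃, ∃ F₂ ∈ cornerFrames L₂ σ₂ (-e₃), CoAxFrames F₁ F₂ := by
      rcases frameClasses_of_not_framesApart hFA with h | h | h
      · exact coaxialClass_of_sharedClass h
      · exact coaxialClass_of_twinClass h
      · exact h
    exact bilayerWallAt_mono hR₀0 e5 (hC₅ σ₁ σ₂ hσ₁ hσ₂ L₁ L₂ s₁ s₂ A₁ A₂ u₁ u₂ hu₁ hu₂ c m hadm hdom hcl)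
  by_cases hRow : RowMixDominated (Real.sqrt 2 / 2) L₁ σ₁ L₂ σ₂ c
  · by_cases hFA : FramesApart L₁ s₁ σ₁ L₂ s₂ σ₂
    · exact bilayerWallAt_mono hR₀0 e1 (hC₁ σ₁ σ₂ hσ₁ hσ₂ L₁ L₂ s₁ s₂ c hadm.1 hRow hFA)
    · exact classes (Or.inr hRow) hFA
  · rcases H with ⟨hS₁, hS₂, hFD, hBOR⟩ | ⟨hRow', -⟩
    · by_cases hZG : ZigGood L₁ σ₁ e₃ ∧ ZigGood L₂ σ₂ (-e₃)
      · by_cases hFA : FramesApart L₁ s₁ σ₁ L₂ s₂ σ₂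
        · exact bilayerWallAt_mono hR₀0 e2
            (hC₂ σ₁ σ₂ hσ₁ hσ₂ L₁ L₂ s₁ s₂ hZG.1.1 hZG.2.1 (zigFramesApart_of_framesApart hZG.1 hZG.2 hFA) c hadm.1 hFD)
        · exact classes (Or.inl ⟨hZG.1, hZG.2, hFD⟩) hFA
      · exact bilayerWallAt_mono hR₀0 e6
          (hC₆ σ₁ σ₂ hσ₁ hσ₂ L₁ L₂ s₁ s₂ A₁ A₂ u₁ u₂ hu₁ hu₂ c m hadm hS₁ hS₂ hFD hBOR hRow hZG)
    · exact absurd hRow' hRow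

/-- **On-reach (free) at cap `c₀`, plate 1 flipped** (`onReachAllAt_flip₁` minus `hgen`). -/
theorem onReachAllFreeAt_flip₁ {OffR : (E3 ≃ₗᵢ[ℝ] E3) → E3 → (ℤ → ℤ) → (E3 ≃ₗᵢ[ℝ] E3) → E3 → (ℤ → ℤ) → Prop} {c₀ C R₀ : ℝ}
    (hOR : BilayerWallOnReachAllFreeAt OffR c₀ C R₀) {σ₁ σ₂ : ℤ → ℤ} (hσ₁ : IsHaggSeq σ₁) (hσ₂ : IsHaggSeq σ₂)
    {L₁ L₂ : E3 ≃ₗᵢ[ℝ] E3} {s₁ s₂ : E3} {A₁ A₂ : ℤ → (E3 ≃ₗᵢ[ℝ] E3)} {u₁ u₂ : ℤ → E3}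
    (hF₁ : BilayerFramesAt L₁ s₁ σ₁ A₁ u₁) (hF₂ : BilayerFramesAt L₂ s₂ σ₂ A₂ u₂)
    {c : ℤ → ℤ → ℝ} {m : ℤ → ℤ → E3} (hadm : BilayerChargeAdmissibleAt c₀ A₁ A₂ c m)
    (hon : (DeltaSteep (basalMirror.trans L₁) e₃ ∧ DeltaSteep L₂ (-e₃) ∧
        FluxDominated (Real.sqrt 2 / 2) (basalMirror.trans L₁) (fun n => -σ₁ (-n - 1)) L₂ σ₂ (fun i j => c (-i - 1) j) ∧
        ¬ BarlowOffReach (basalMirror.trans L₁) s₁ (fun n => -σ₁ (-n - 1)) L₂ s₂ σ₂) ∨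
      (RowMixDominated (Real.sqrt 2 / 2) (basalMirror.trans L₁) (fun n => -σ₁ (-n - 1)) L₂ σ₂ (fun i j => c (-i - 1) j) ∧
        ¬ OffR (basalMirror.trans L₁) s₁ (fun n => -σ₁ (-n - 1)) L₂ s₂ σ₂)) :
    BilayerWallAt C R₀ σ₁ σ₂ L₁ L₂ s₁ s₂ c :=
  bilayerWallAt_flip₁.1
    (hOR _ _ (isHaggSeq_reverse hσ₁) hσ₂ _ _ _ _ _ _ _ _ (bilayerFramesAt_flip hF₁) hF₂ _ _
      (bilayerChargeAdmissibleAt_flip₁ hadm) hon)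

/-- **On-reach (free) at cap `c₀`, plate 2 flipped.** -/
theorem onReachAllFreeAt_flip₂ {OffR : (E3 ≃ₗᵢ[ℝ] E3) → E3 → (ℤ → ℤ) → (E3 ≃ₗᵢ[ℝ] E3) → E3 → (ℤ → ℤ) → Prop} {c₀ C R₀ : ℝ}
    (hOR : BilayerWallOnReachAllFreeAt OffR c₀ C R₀) {σ₁ σ₂ : ℤ → ℤ} (hσ₁ : IsHaggSeq σ₁) (hσ₂ : IsHaggSeq σ₂)
    {L₁ L₂ : E3 ≃ₗᵢ[ℝ] E3} {s₁ s₂ : E3} {A₁ A₂ : ℤ → (E3 ≃ₗᵢ[ℝ] E3)} {u₁ u₂ : ℤ → E3}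
    (hF₁ : BilayerFramesAt L₁ s₁ σ₁ A₁ u₁) (hF₂ : BilayerFramesAt L₂ s₂ σ₂ A₂ u₂)
    {c : ℤ → ℤ → ℝ} {m : ℤ → ℤ → E3} (hadm : BilayerChargeAdmissibleAt c₀ A₁ A₂ c m)
    (hon : (DeltaSteep L₁ e₃ ∧ DeltaSteep (basalMirror.trans L₂) (-e₃) ∧
        FluxDominated (Real.sqrt 2 / 2) L₁ σ₁ (basalMirror.trans L₂) (fun n => -σ₂ (-n - 1)) (fun i j => c i (-j - 1)) ∧
        ¬ BarlowOffReach L₁ s₁ σ₁ (basalMirror.trans L₂) s₂ (fun n => -σ₂ (-n - 1))) ∨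
      (RowMixDominated (Real.sqrt 2 / 2) L₁ σ₁ (basalMirror.trans L₂) (fun n => -σ₂ (-n - 1)) (fun i j => c i (-j - 1)) ∧
        ¬ OffR L₁ s₁ σ₁ (basalMirror.trans L₂) s₂ (fun n => -σ₂ (-n - 1)))) :
    BilayerWallAt C R₀ σ₁ σ₂ L₁ L₂ s₁ s₂ c :=
  bilayerWallAt_flip₂.1
    (hOR _ _ hσ₁ (isHaggSeq_reverse hσ₂) _ _ _ _ _ _ _ _ hF₁ (bilayerFramesAt_flip hF₂) _ _
      (bilayerChargeAdmissibleAt_flip₂ hadm) hon)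

/-- **On-reach (free) at cap `c₀`, both plates flipped.** -/
theorem onReachAllFreeAt_flip₁₂ {OffR : (E3 ≃ₗᵢ[ℝ] E3) → E3 → (ℤ → ℤ) → (E3 ≃ₗᵢ[ℝ] E3) → E3 → (ℤ → ℤ) → Prop} {c₀ C R₀ : ℝ}
    (hOR : BilayerWallOnReachAllFreeAt OffR c₀ C R₀) {σ₁ σ₂ : ℤ → ℤ} (hσ₁ : IsHaggSeq σ₁) (hσ₂ : IsHaggSeq σ₂)
    {L₁ L₂ : E3 ≃ₗᵢ[ℝ] E3} {s₁ s₂ : E3} {A₁ A₂ : ℤ → (E3 ≃ₗᵢ[ℝ] E3)} {u₁ u₂ : ℤ → E3}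
    (hF₁ : BilayerFramesAt L₁ s₁ σ₁ A₁ u₁) (hF₂ : BilayerFramesAt L₂ s₂ σ₂ A₂ u₂)
    {c : ℤ → ℤ → ℝ} {m : ℤ → ℤ → E3} (hadm : BilayerChargeAdmissibleAt c₀ A₁ A₂ c m)
    (hon : (DeltaSteep (basalMirror.trans L₁) e₃ ∧ DeltaSteep (basalMirror.trans L₂) (-e₃) ∧
        FluxDominated (Real.sqrt 2 / 2) (basalMirror.trans L₁) (fun n => -σ₁ (-n - 1))
          (basalMirror.trans L₂) (fun n => -σ₂ (-n - 1)) (fun i j => c (-i - 1) (-j - 1)) ∧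
        ¬ BarlowOffReach (basalMirror.trans L₁) s₁ (fun n => -σ₁ (-n - 1)) (basalMirror.trans L₂) s₂ (fun n => -σ₂ (-n - 1))) ∨
      (RowMixDominated (Real.sqrt 2 / 2) (basalMirror.trans L₁) (fun n => -σ₁ (-n - 1))
          (basalMirror.trans L₂) (fun n => -σ₂ (-n - 1)) (fun i j => c (-i - 1) (-j - 1)) ∧
        ¬ OffR (basalMirror.trans L₁) s₁ (fun n => -σ₁ (-n - 1)) (basalMirror.trans L₂) s₂ (fun n => -σ₂ (-n - 1)))) :
    BilayerWallAt C R₀ σ₁ σ₂ L₁ L₂ s₁ s₂ c :=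
  bilayerWallAt_flip₁.1
    (onReachAllFreeAt_flip₂ hOR (isHaggSeq_reverse hσ₁) hσ₂ (bilayerFramesAt_flip hF₁) hF₂
      (bilayerChargeAdmissibleAt_flip₁ hadm) hon)

/-- **Walker-covered (frames-free) ∪ row-covered (frames-free) ∪ on-reach (free) ∪ deficit-MIN (free) ⇒ THE WHOLE LAW at cap `c₀` in
frames-∀ form, one `R₀ ≥ 0`** (`genericAt_of_four_min`'s tree with no `hgen`; the row-covered flips are redone inline on the frames-free form). -/
theorem allAt_of_four_min {c₀ R₀ C₁ C₂ C₃ C₄ : ℝ} (hR₀0 : 0 ≤ R₀)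
    (hC₁ : ∀ (σ₁ σ₂ : ℤ → ℤ), IsHaggSeq σ₁ → IsHaggSeq σ₂ → ∀ (L₁ L₂ : E3 ≃ₗᵢ[ℝ] E3) (s₁ s₂ : E3),
      BarlowCoverable L₁ s₁ σ₁ L₂ s₂ σ₂ → ∀ c : ℤ → ℤ → ℝ, (∀ i j, 0 ≤ c i j) →
      FluxDominated (Real.sqrt 2 / 2) L₁ σ₁ L₂ σ₂ c → BilayerWallAt C₁ R₀ σ₁ σ₂ L₁ L₂ s₁ s₂ c)
    (hC₂ : ∀ (σ₁ σ₂ : ℤ → ℤ), IsHaggSeq σ₁ → IsHaggSeq σ₂ → ∀ (L₁ L₂ : E3 ≃ₗᵢ[ℝ] E3) (s₁ s₂ : E3),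
      ∀ c : ℤ → ℤ → ℝ, (∀ i j, 0 ≤ c i j) → RowMixDominated (Real.sqrt 2 / 2) L₁ σ₁ L₂ σ₂ c →
      FramesApart L₁ s₁ σ₁ L₂ s₂ σ₂ → BilayerWallAt C₂ R₀ σ₁ σ₂ L₁ L₂ s₁ s₂ c)
    (hC₃ : BilayerWallOnReachAllFreeAt FramesApart c₀ C₃ R₀) (hC₄ : BilayerWallDeficitMinFreeAt c₀ C₄ R₀) :
    BilayerWallAllAt c₀ (max (max C₁ C₂) (max C₃ C₄)) R₀ := by
  classical
  have h2 : C₂ ≤ max (max C₁ C₂) (max C₃ C₄) := le_trans (le_max_right _ _) (le_max_left _ _)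
  have h3 : C₃ ≤ max (max C₁ C₂) (max C₃ C₄) := le_trans (le_max_left _ _) (le_max_right _ _)
  intro σ₁ σ₂ hσ₁ hσ₂ L₁ L₂ s₁ s₂ A₁ A₂ u₁ u₂ hu₁ hu₂ c m hadm
  have hc0 : ∀ i j, 0 ≤ c i j := hadm.1
  -- the row-covered part in the three flipped presentations (frames-free, so the flips are two rewrites)
  have row₁ : RowMixDominated (Real.sqrt 2 / 2) (basalMirror.trans L₁) (fun n => -σ₁ (-n - 1)) L₂ σ₂ (fun i j => c (-i - 1) j) →
      FramesApart (basalMirror.trans L₁) s₁ (fun n => -σ₁ (-n - 1)) L₂ s₂ σ₂ → BilayerWallAt C₂ R₀ σ₁ σ₂ L₁ L₂ s₁ s₂ c :=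
    fun hdom hoff => bilayerWallAt_flip₁.1
      (hC₂ _ _ (isHaggSeq_reverse hσ₁) hσ₂ _ _ _ _ _ (fun _ _ => hc0 _ _) hdom hoff)
  have row₂ : RowMixDominated (Real.sqrt 2 / 2) L₁ σ₁ (basalMirror.trans L₂) (fun n => -σ₂ (-n - 1)) (fun i j => c i (-j - 1)) →
      FramesApart L₁ s₁ σ₁ (basalMirror.trans L₂) s₂ (fun n => -σ₂ (-n - 1)) → BilayerWallAt C₂ R₀ σ₁ σ₂ L₁ L₂ s₁ s₂ c :=
    fun hdom hoff => bilayerWallAt_flip₂.1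
      (hC₂ _ _ hσ₁ (isHaggSeq_reverse hσ₂) _ _ _ _ _ (fun _ _ => hc0 _ _) hdom hoff)
  have row₁₂ : RowMixDominated (Real.sqrt 2 / 2) (basalMirror.trans L₁) (fun n => -σ₁ (-n - 1))
        (basalMirror.trans L₂) (fun n => -σ₂ (-n - 1)) (fun i j => c (-i - 1) (-j - 1)) →
      FramesApart (basalMirror.trans L₁) s₁ (fun n => -σ₁ (-n - 1)) (basalMirror.trans L₂) s₂ (fun n => -σ₂ (-n - 1)) →
      BilayerWallAt C₂ R₀ σ₁ σ₂ L₁ L₂ s₁ s₂ c :=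
    fun hdom hoff => bilayerWallAt_flip₁.1 (bilayerWallAt_flip₂.1
      (hC₂ _ _ (isHaggSeq_reverse hσ₁) (isHaggSeq_reverse hσ₂) _ _ _ _ _ (fun _ _ => hc0 _ _) hdom hoff))
  by_cases hZ : DeltaSteep L₁ e₃ ∧ DeltaSteep L₂ (-e₃) ∧ FluxDominated (Real.sqrt 2 / 2) L₁ σ₁ L₂ σ₂ c
  · by_cases hoff : BarlowOffReach L₁ s₁ σ₁ L₂ s₂ σ₂
    · exact bilayerWallAt_mono hR₀0 (le_trans (le_max_left _ _) (le_max_left _ _))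
        (hC₁ σ₁ σ₂ hσ₁ hσ₂ L₁ L₂ s₁ s₂ ⟨hZ.1, hZ.2.1, hoff⟩ c hc0 hZ.2.2)
    · exact bilayerWallAt_mono hR₀0 h3
        (hC₃ σ₁ σ₂ hσ₁ hσ₂ L₁ L₂ s₁ s₂ A₁ A₂ u₁ u₂ hu₁ hu₂ c m hadm (Or.inl ⟨hZ.1, hZ.2.1, hZ.2.2, hoff⟩))
  · by_cases hRow : RowMixDominated (Real.sqrt 2 / 2) L₁ σ₁ L₂ σ₂ c
    · by_cases hoff : FramesApart L₁ s₁ σ₁ L₂ s₂ σ₂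
      · exact bilayerWallAt_mono hR₀0 h2 (hC₂ σ₁ σ₂ hσ₁ hσ₂ L₁ L₂ s₁ s₂ c hc0 hRow hoff)
      · exact bilayerWallAt_mono hR₀0 h3
          (hC₃ σ₁ σ₂ hσ₁ hσ₂ L₁ L₂ s₁ s₂ A₁ A₂ u₁ u₂ hu₁ hu₂ c m hadm (Or.inr ⟨hRow, hoff⟩))
    · by_cases hRow₁ : RowMixDominated (Real.sqrt 2 / 2) (basalMirror.trans L₁) (fun n => -σ₁ (-n - 1)) L₂ σ₂
          (fun i j => c (-i - 1) j)
      · by_cases hoff : FramesApart (basalMirror.trans L₁) s₁ (fun n => -σ₁ (-n - 1)) L₂ s₂ σ₂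
        · exact bilayerWallAt_mono hR₀0 h2 (row₁ hRow₁ hoff)
        · exact bilayerWallAt_mono hR₀0 h3 (onReachAllFreeAt_flip₁ hC₃ hσ₁ hσ₂ hu₁ hu₂ hadm (Or.inr ⟨hRow₁, hoff⟩))
      · by_cases hRow₂ : RowMixDominated (Real.sqrt 2 / 2) L₁ σ₁ (basalMirror.trans L₂) (fun n => -σ₂ (-n - 1))
            (fun i j => c i (-j - 1))
        · by_cases hoff : FramesApart L₁ s₁ σ₁ (basalMirror.trans L₂) s₂ (fun n => -σ₂ (-n - 1))
          · exact bilayerWallAt_mono hR₀0 h2 (row₂ hRow₂ hoff)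
          · exact bilayerWallAt_mono hR₀0 h3 (onReachAllFreeAt_flip₂ hC₃ hσ₁ hσ₂ hu₁ hu₂ hadm (Or.inr ⟨hRow₂, hoff⟩))
        · by_cases hRow₁₂ : RowMixDominated (Real.sqrt 2 / 2) (basalMirror.trans L₁) (fun n => -σ₁ (-n - 1))
              (basalMirror.trans L₂) (fun n => -σ₂ (-n - 1)) (fun i j => c (-i - 1) (-j - 1))
          · by_cases hoff : FramesApart (basalMirror.trans L₁) s₁ (fun n => -σ₁ (-n - 1)) (basalMirror.trans L₂) s₂
                (fun n => -σ₂ (-n - 1))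
            · exact bilayerWallAt_mono hR₀0 h2 (row₁₂ hRow₁₂ hoff)
            · exact bilayerWallAt_mono hR₀0 h3 (onReachAllFreeAt_flip₁₂ hC₃ hσ₁ hσ₂ hu₁ hu₂ hadm (Or.inr ⟨hRow₁₂, hoff⟩))
          · exact bilayerWallAt_mono hR₀0 (le_trans (le_max_right _ _) (le_max_right _ _))
              (hC₄ σ₁ σ₂ hσ₁ hσ₂ L₁ L₂ s₁ s₂ A₁ A₂ u₁ u₂ hu₁ hu₂ c m hadm hZ hRow hRow₁ hRow₂ hRow₁₂)

/-! ## The composition, nine stubs -/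

/-- **The wall law at cap `c₀` (`0 ≤ c₀ ≤ 1`, `R₀ ≥ 10`) from the v8.1 inputs**: E1-data + StarPairFar facts (faulted generic branch), F-U,
lane G's uniform deficiency-form charge-`c₀` ledger, T-F2 free at cap `c₀` (both keys), the free faulted payer pool — NO residual input. -/
theorem bilayerWallCharged_of_stubsFree
    {sE : E3} (hsE : sE ∈ fccSlots) (hcert : ExactOnly 0 (fccSlots.filter fun w => 0 < ⟪w, sE⟫_ℝ))
    (hDS : ∀ F₁ F₂ : E3 ≃ₗᵢ[ℝ] E3, DoubleStarCoaxialAt F₁ F₂) (hCP : CapPairCoaxial) {c₀ R₀ : ℝ} (hc₀ : 0 ≤ c₀) (hc₁ : c₀ ≤ 1)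
    (h10 : 10 ≤ R₀) (hF : ∃ C : ℝ, CoaxialUnifAt C R₀)
    (hG : ∃ K : ℝ, ∀ (P₁ : E3 ≃ₗᵢ[ℝ] E3) (t₁ : E3) (P₂ : E3 ≃ₗᵢ[ℝ] E3) (t₂ : E3),
      ¬ (∃ (L : E3 ≃ₗᵢ[ℝ] E3) (r₁ r₂ : E3) (σ σ' : ℤ → ℤ), IsHaggSeq σ ∧ IsHaggSeq σ' ∧
        (fun p => P₁ p + t₁) '' fccStacking 1 (Real.sqrt (2 / 3)) ⊆
          (fun p => L p + r₁) '' barlowStacking 1 (Real.sqrt (2 / 3)) σ ∧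
        (fun p => P₂ p + t₂) '' fccStacking 1 (Real.sqrt (2 / 3)) ⊆
          (fun p => L p + r₂) '' barlowStacking 1 (Real.sqrt (2 / 3)) σ') →
      GenericWallFloorWithCharge K R₀ c₀ P₁ t₁ P₂ t₂)
    (hFault : (∃ C : ℝ, BilayerWallFaultedOnReachCoaxialFreeAt c₀ C R₀) ∧ (∃ C : ℝ, BilayerWallFaultedZigCoaxialFreeAt c₀ C R₀))
    (hPool : ∃ C : ℝ, HStripPayerPoolFaultedFreeAt c₀ C R₀) : BilayerWallCharged c₀ := by
  have hR₀6 : 6 ≤ R₀ := by linarith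
  have hR₀0 : 0 ≤ R₀ := by linarith
  obtain ⟨C_B, hB⟩ := bothFccAt_of_withCharge hc₀ hc₁ (by linarith) hF hG
  obtain ⟨⟨C_f, hf⟩, ⟨C_z, hz⟩⟩ := hFault
  obtain ⟨C_W, hW⟩ := walkerCoveredFree_of_F4 hsE hcert hDS hCP hR₀6
  obtain ⟨C_R, hR⟩ := rowCovFree_framesApart hsE hcert hDS hCP hR₀6
  obtain ⟨C_A, hA⟩ := zigFramesApartFree_of_cert hsE hcert hDS hCP hR₀6
  have hO := onReachAllFreeAt_of_split hR₀0 hR hA (onReachCoaxialFreeAt_of_bothFccAt hR₀0 hB hf)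
    (onReachWeakZigFreeAt_of_zigSplit hR₀0 hA (zigCoaxialFreeAt_of_bothFccAt hR₀0 hB hz))
  obtain ⟨C_D, hD⟩ := deficitMinFreeAt_of_bothFccAt (by linarith) hB hPool
  exact bilayerWallCharged_of_allAt (by linarith) (allAt_of_four_min hR₀0 hW hR hO hD)

/-- **`BilayerWallV5` from the TexShadow v8.1 inputs at one `R₀ ≥ 10`**: E1-data, the StarPairFar facts, F-U (`∃ C, CoaxialUnifAt C R₀`), lane
G's charge-`13/25` ledger `∃ K, ∀ P₁ t₁ P₂ t₂, ¬(affine coax) → GenericWallFloorWithCharge K R₀ (13/25) …`, T-F2 at `13/25` WITHOUT `hgen` (both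
keys), the faulted h-strip payer pool at `13/25` WITHOUT `hgen` — and no residual stub. -/
theorem bilayerWallV5_of_stubsBothFccFirstFree
    {sE : E3} (hsE : sE ∈ fccSlots) (hcert : ExactOnly 0 (fccSlots.filter fun w => 0 < ⟪w, sE⟫_ℝ))
    (hDS : ∀ F₁ F₂ : E3 ≃ₗᵢ[ℝ] E3, DoubleStarCoaxialAt F₁ F₂) (hCP : CapPairCoaxial) {R₀ : ℝ} (h10 : 10 ≤ R₀)
    (hF : ∃ C : ℝ, CoaxialUnifAt C R₀)
    (hG : ∃ K : ℝ, ∀ (P₁ : E3 ≃ₗᵢ[ℝ] E3) (t₁ : E3) (P₂ : E3 ≃ₗᵢ[ℝ] E3) (t₂ : E3),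
      ¬ (∃ (L : E3 ≃ₗᵢ[ℝ] E3) (r₁ r₂ : E3) (σ σ' : ℤ → ℤ), IsHaggSeq σ ∧ IsHaggSeq σ' ∧
        (fun p => P₁ p + t₁) '' fccStacking 1 (Real.sqrt (2 / 3)) ⊆
          (fun p => L p + r₁) '' barlowStacking 1 (Real.sqrt (2 / 3)) σ ∧
        (fun p => P₂ p + t₂) '' fccStacking 1 (Real.sqrt (2 / 3)) ⊆
          (fun p => L p + r₂) '' barlowStacking 1 (Real.sqrt (2 / 3)) σ') →
      GenericWallFloorWithCharge K R₀ (13 / 25) P₁ t₁ P₂ t₂)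
    (hFault : (∃ C : ℝ, BilayerWallFaultedOnReachCoaxialFreeAt (13 / 25) C R₀) ∧
      (∃ C : ℝ, BilayerWallFaultedZigCoaxialFreeAt (13 / 25) C R₀))
    (hPool : ∃ C : ℝ, HStripPayerPoolFaultedFreeAt (13 / 25) C R₀) : BilayerWallV5 :=
  bilayerWallCharged_of_stubsFree hsE hcert hDS hCP (by norm_num) (by norm_num) h10 hF hG hFault hPool

end Summit.Ventures.Crystal3D.Cruxes.TextureLiminf.TexShadow

end
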